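import Literature.MathematicalPhysics.QuantumFieldTheory.Balaban1983to89.B9Thm33GlobalBlockWitnessZdPerNested
import Literature.MathematicalPhysics.QuantumFieldTheory.Balaban1983to89.B9Thm33SourceWitnessZdPer
import Literature.MathematicalPhysics.QuantumFieldTheory.Balaban1983to89.Node00.CarriersB8SubDKappa

/-!
# `Balaban1983to89.B9Thm33SourceWitnessZdPerNested` — [Balaban1985BackgroundPropagators] Thm 3.3 (3.42)₃ ∕ (3.43) p. 397–398 for the SOURCE TERM `G(U₀) D R^per(U₀) D* A`
# under [Balaban1985RegularSpaces] Thm 8's (1.146) AT EVERY NESTED PERIODIC MEMBER (print's class (1.31) `towerBondsP`, every truncation `m ≤ k`), PER MEMBER, for the GENUINE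
# periodic record `opsAllZdPer`: the source binders `SrcAtIPer ∕ SrcHolderAtIH2Per` INHABITED, and THE FIVE ANALYTIC BINDERS OF THE N05 WITNESS SLOT OF RECORD
# (`InvAtHIPer ∕ GlobAtIPer ∕ HolderAtIH2Per ∕ SrcAtIPer ∕ SrcHolderAtIH2Per`) PACKAGED AT THE MEMBER WITH ONE THRESHOLD PAIR `(aI, aT)` — dag-n06-b g24's
# `B9Thm33SourceWitnessZdPer` (all-torus member) generalised: its «Ω_j = ℤᵈ» was used at level `0` only

statement-level skeleton of published theorems with citation tags; proofs where landed; nothing here is a claim about the Yang–Mills mass gap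

`[Balaban1985BackgroundPropagators]` ("B9", CMP **99** (1985) 389–434): Thm 3.3 p. 399, (3.20)–(3.22) p. 394, (3.26)–(3.27) p. 395, (3.40) p. 397, (3.42) p. 397, (3.43)–(3.47)
p. 398, Thm 3.11 p. 416.  `[Balaban1985RegularSpaces]` ("B8", CMP **99**) Thm 8 + (1.146) p. 101, (1.55) p. 86, (1.58)–(1.59) p. 86, (1.39) p. 82, (1.3)–(1.6) p. 77, (1.31) p. 82,
p. 92, p. 77 «Ω_j ⊂ T_η».

CITATION HEADER (lean-in-tree rule).  Cell `pub-ymgap` (YM Track A), DAG node N06 = [B9], seat `pub-ymgap-dag-n06-b` (g25), the (β′-PERIODIC) road; own take of HANDOFF §2r (b).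
WHY: the N05 witness slot of record (R467, `…N05SubBP2DK2PerKappaSlotExistsOfBindersLettersPer(Door)`) displays NODE N06's five analytic binders at every member
`a : IdxB8SubDPerκ θ P Mκ Rκ` and truncation `m ≤ k`; this seat's g25 files inhabit `InvAtHIPer` (`B9Thm311ClassCompactnessZdPerNested`) and `GlobAtIPer ∕ HolderAtIH2Per`
(`B9Thm33GlobalBlockWitnessZdPerNested`) per member; THIS FILE adds the two SOURCE binders and packages all five.  §1 re-derives g24's size bound `|D R^per D* A|₍₋₃₎ ≤
2K(Lᵐ)³|f|₍₋₂₎` with «`Ω₀ = ℤᵈ`» only (g24 displayed «Ω_j = ℤᵈ ∀ j» but used level `0`: the pointwise size of `f` from the level-`0` term of `|f|₍₋₂,Ω₎` and (1.146) on `Ω₀`);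
§2 `GlobAtIPer ⟹ SrcAtIPer` and `HolderAtIH2Per ⟹ SrcHolderAtIH2Per` at any class ∕ any nested `Ω` with `Ω₀ = ℤᵈ` (the Hölder binder is the INPUT — no Hölder-from-global knit,
hence no «Ω_j = ℤᵈ»); §3 the member package.

WHAT IS PROVED (kernel, 0 sorry; theorems only — no `def`, no `instance`, no `notation`).
* §1 ★★ `bondNorm_DRDs_le_of_src_of_zero`.
* §2 ★★★ `srcAtIPer_of_globAtIPer_of_zero`, ★★★ `srcHolderAtIH2Per_of_holderAtIH2Per_of_zero`.
* §3 ★★★★★ `IdxB8SubDPer.binders_opsAllZdPer` — `∃ aI aT B₀ > 0, K ≥ 1`: `InvAtHIPer … aI`, `GlobAtIPer … aT B₀`, `HolderAtIH2Per … aT (2B₀(Lᵐ)^β) β len`, `SrcAtIPer … aT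
  (B₀·2K(Lᵐ)³)`, `SrcHolderAtIH2Per … aT (2B₀(Lᵐ)^β·2K(Lᵐ)³) β len` for `opsAllZdPer τ θ.L P (fun k j => towerBondsP θ.L a.toZdIdx.Ω (a.toZdIdx.Λs k) j) ops₀` at
  `(a, m)` (`2 ≤ D`, `0 ≤ β`, integer lengths) — the N05 head's `hinv ∕ hglob ∕ hhol ∕ hsrc ∕ hsrcH` texts AT THE MEMBER.
* §4 ★★★★★ `IdxB8SubDPer.binders_opsAllZdPer_allLevels` — ONE constant set `aI aT B₀ C_β c_S c_Sβ` for ALL truncations `m ≤ K` (`K ≤ k`) at a fixed member (`min ∕ max` over the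
  truncations through the lineage's `…_anti` lemmas) — the head's `∀ m ≤ k` shape per member.
* §5 ★★★★★ `IdxB8SubDPerκ.binders_opsAllZdPer_allLevels` — the same on the head's own index `IdxB8SubDPerκ θ P M₁ R` (through `toPer`; `toZdIdx` agrees by `rfl`).

HONEST SCOPE.  (i) PER MEMBER: the constants exist by compactness and depend on `(a, m)` (`η`, `k`, `Ω`), `P`, `τ`, the record; the N05 head displays ONE constant set for ALL
members and truncations — for a FIXED member the finitely many `m ≤ k` combine by `min ∕ max` (the binders are antitone in thresholds, monotone in constants; successor
packaging à la g24's `B9Thm33SocketUniformLevelsZdPer`), but uniformity over members (`η`-scaling, volume-uniform Theorem 3.3 ∕ 3.11) is NOT proved here and is the content of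
the coercivity ∕ random-walk lanes.  (ii) [4]'s periodic LETTERS `hLet ∕ SLetUB` at nested members (the head's other displayed hypotheses) are NOT this file's (lit-balaban).
(iii) Count-neutral; N06 NOT discharged; K1⁹ NOT closed; counts UNMOVED; one finite `𝕋⁴` programme at fixed `ε`, Bałaban as printed; nothing continuum ∕ ℝ⁴ ∕ OS ∕ mass gap ∕
Clay.  Unit `pub-ymgap-dag-n06-b` (g25), 2026-08-28; NEW file importing this seat's `B9Thm33GlobalBlockWitnessZdPerNested`, `B9Thm33SourceWitnessZdPer` (g24) and dag-n05-w1's `Node00.CarriersB8SubDKappa`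
(the head's index); modifies nothing.  Net new unproved facts: 0.
-/

noncomputable section

namespace Literature.MathematicalPhysics.QuantumFieldTheory.Balaban1983to89.B9Thm33SourceWitnessZdPerNested

open B7Prop1Explicit B7Prop2Explicit
open B7Prop1Local (InBox loK bondHiK)
open B8Ineq132 (covDerivFwd covDeriv InAk BondTouches plaqF)
open B8Eq140Level (SideTouches)
open B8ScaledSupNorm (bondNorm msup weight Bdd)
open B8Eq138LandauZd (covLap covDivB QT)
open B8LeafModelZd (ZdIdx)
open B9Eq340HolderZd (hquot AdmPair trans hquot_nonneg)
open B9SupplySockB9P3ZdLetters (OpsZd deltaAOf)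
open B9SupplySockB9P3ZdLettersOmega (OnDom norm_covDerivFwd_le)
open B9SupplySockB9P3ZdGammaInAkDpZd (withDpZd)
open B9Eq316AveragingTransposeZdPrinted (withQQP)
open B9Eq327GreenZdHermPer (domSubHPer mem_domSubHPer_iff InvAtHIPer isPeriodic_apply_dir)
open B9SupplySockB9P3ZdPer (GlobAtIPer)
open B9SupplySockB9P3ZdH2Per (HolderAtIH2Per)
open B9SupplySockB9P3ZdAllLettersZdPer (opsAllZdPer opsLandauPer opsAllZdPer_DRDs DRDs_mem_domSubHPer)
open B9SupplySockB9P3ZdSrcPer (SrcAtIPer SrcHolderAtIH2Per)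
open B9Eq321LandauProjectionZdPer (perSub formPer projRPer)
open B9Thm33GlobalBlockWitnessCubeZd (exists_norm_sq_le_re_trace)
open B9Thm33SourceWitnessZdPer (norm_le_of_bdd_neg_two norm_covDerivFwd_projRPer_le DRDs_opsAllZdPer_eq_of_src norm_le_sum_cell_of_isPeriodic)
open B8TowerBondsPrinted (towerBondsP)
open Node00 (Stage3Params IdxB8SubD IdxB8SubDPer IdxB8SubDPerκ)
open T4TermwiseTorus (IsPeriodic box tlift tcls card_box tlift_mem_box)

-- `Site` alone could resolve to the torus sites of `Setup.lean`; re-export the `ℤ^d` sites of `B7Prop1Explicit`.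
export B7Prop1Explicit (Site)

variable {d : ℕ} {𝔸 : Type*} [CStarAlgebra 𝔸]

/-! ## §1  The size of the source letter `D R^per(U₀) D* A = D R^per f` over ANY region sequence with `Ω₀ = ℤᵈ` -/

section Size

variable (τ : 𝔸 →ₗ[ℂ] ℂ) (P : ℕ) {L : ℕ} [NeZero P] [NeZero L] {U₀ : Site d → Fin d → 𝔸ˣ} {m : ℕ}

/-- ★★ **THE SOURCE LETTER IN THE `|·|₍₋₃,Ω₎` NORM AT A MEMBER WITH `Ω₀ = ℤᵈ`** (any nested `Ω_j`, `j ≥ 1`): under (1.146), for the genuine periodic record,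
`|D R^per(U₀) D* A|₍₋₃,Ω₎ ≤ 2·max{1, PᵈC_τ∕κ}·(Lᵐ)³·|f|₍₋₂,Ω₎` (`U₀` unitary periodic, `A`, `f` periodic, `f` bounded in `|·|₍₋₂,Ω₎`, `Lᵐ ∣ P`, `1 ≤ L`).  dag-n06-b g24's
`bondNorm_DRDs_le_of_src` asked `Ω_j = ℤᵈ` at every level but used it at level `0` only (the pointwise size of `f` from the level-`0` term of `|f|₍₋₂₎`, and (1.146) on `Ω₀`).
[cite: Balaban1985BackgroundPropagators, (3.26) p.395, (3.42) p.397, (3.20)–(3.22) p.394; Balaban1985RegularSpaces, (1.146) p.101, (1.58) p.86, (1.55) p.86, p.77] -/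
theorem bondNorm_DRDs_le_of_src_of_zero [FiniteDimensional ℝ 𝔸] [Nontrivial 𝔸] (hτt : ∀ a b : 𝔸, τ (a * b) = τ (b * a))
    (hτs : ∀ a : 𝔸, τ (star a) = starRingEnd ℂ (τ a)) (hτp : ∀ a : 𝔸, a ≠ 0 → 0 < (τ (star a * a)).re)
    {Cτ : ℝ} (hCτ : ∀ x y : 𝔸, |(τ (star x * y)).re| ≤ Cτ * ‖x‖ * ‖y‖) {κ : ℝ} (hκ : 0 < κ) (hκle : ∀ a : 𝔸, κ * ‖a‖ ^ 2 ≤ (τ (star a * a)).re)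
    (hL : 1 ≤ L) (ΛbP : ℕ → ℕ → Set (Site d × Fin d)) (ops₀ : ℝ → ZdIdx d L → ℕ → OpsZd d 𝔸) (M : ℝ) {i : ZdIdx d L} (hΩ : i.Ω 0 = Set.univ)
    (hP : L ^ m ∣ P) (hUu : ∀ (x : Site d) (κ : Fin d), U₀ x κ ∈ unitaryUnits 𝔸) (hU : IsPeriodic P U₀)
    {A : Site d → Fin d → 𝔸} (hA : IsPeriodic P A) {f : Site d → 𝔸} (hf : IsPeriodic P f)
    (hfB : Bdd L i.k i.η (-(2 : ℝ)) (fun j (x : Site d) => x ∈ i.Ω j) f)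
    (hcl : ∃ μ : ℕ → Site d → 𝔸, ∀ x ∈ i.Ω 0, covLap i.η U₀ ((i.Ω 0).indicator (covDivB i.η U₀ A - f)) x = QT L m (i.Λs m) U₀ μ x) :
    bondNorm L m i.η (-(3 : ℝ)) i.Ω (fun x μ => (opsAllZdPer τ L P ΛbP ops₀ M i m).DRDs U₀ A x μ) ≤
      2 * max 1 (((box (d := d) P).card : ℝ) * Cτ / κ) * ((L : ℝ) ^ m) ^ 3 * msup L i.k i.η (-(2 : ℝ)) (fun j (x : Site d) => x ∈ i.Ω j) f := by
  have hη : 0 < i.η := i.hη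
  have hLr : (1 : ℝ) ≤ L := by exact_mod_cast hL
  set K : ℝ := max 1 (((box (d := d) P).card : ℝ) * Cτ / κ) with hK
  set Nf : ℝ := msup L i.k i.η (-(2 : ℝ)) (fun j (x : Site d) => x ∈ i.Ω j) f with hNf
  have hK0 : 0 ≤ K := le_trans zero_le_one (le_max_left _ _)
  have hNf0 : 0 ≤ Nf := B8ScaledSupNorm.msup_nonneg L i.k hη.le _ _ _
  have hF : ∀ x, ‖f x‖ ≤ (i.η ^ 2)⁻¹ * Nf := fun x => norm_le_of_bdd_neg_two hη hfB (by rw [hΩ]; exact Set.mem_univ x)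
  have hpt : ∀ (x : Site d) (μ : Fin d), ‖(opsAllZdPer τ L P ΛbP ops₀ M i m).DRDs U₀ A x μ‖ ≤ i.η⁻¹ * (2 * (K * ((i.η ^ 2)⁻¹ * Nf))) := by
    intro x μ
    rw [DRDs_opsAllZdPer_eq_of_src τ hτt hτs hτp ΛbP ops₀ M i hΩ hP hUu hU hA hf hcl x μ]
    exact norm_covDerivFwd_projRPer_le τ P hτs hτp hCτ hκ hκle hη hUu L m (i.Λs m) f hF μ x
  refine B8ScaledSupNorm.msup_le (by positivity) fun j hj b _ => ?_
  have e3 : (-(3 : ℝ)) = -((3 : ℕ) : ℝ) := by norm_num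
  rw [e3, B8ScaledSupNorm.weight_neg_natCast]
  have hw : ((L : ℝ) ^ j * i.η) ^ 3 ≤ ((L : ℝ) ^ m * i.η) ^ 3 :=
    pow_le_pow_left₀ (by positivity) (mul_le_mul_of_nonneg_right (pow_le_pow_right₀ hLr hj) hη.le) 3
  calc ((L : ℝ) ^ j * i.η) ^ 3 * ‖(opsAllZdPer τ L P ΛbP ops₀ M i m).DRDs U₀ A b.1 b.2‖
      ≤ ((L : ℝ) ^ m * i.η) ^ 3 * (i.η⁻¹ * (2 * (K * ((i.η ^ 2)⁻¹ * Nf)))) := mul_le_mul hw (hpt b.1 b.2) (norm_nonneg _) (by positivity)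
    _ = 2 * K * ((L : ℝ) ^ m) ^ 3 * Nf * (i.η ^ 3 * i.η⁻¹ * (i.η ^ 2)⁻¹) := by ring
    _ = 2 * K * ((L : ℝ) ^ m) ^ 3 * Nf := by rw [show i.η ^ 3 * i.η⁻¹ * (i.η ^ 2)⁻¹ = 1 by field_simp, mul_one]

end Size

/-! ## §2  Source binders from the global-block ∕ Hölder binders, for the genuine record over ANY class at a member with `Ω₀ = ℤᵈ` -/

section Binders

variable (τ : 𝔸 →ₗ[ℂ] ℂ) (L P : ℕ) [NeZero P] [NeZero L] [FiniteDimensional ℝ 𝔸] [Nontrivial 𝔸]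

/-- ★★★ **`GlobAtIPer ⟹ SrcAtIPer` FOR THE GENUINE PERIODIC RECORD AT A MEMBER WITH `Ω₀ = ℤᵈ`** (any class `𝔅`, any nested `Ω_j`): the source term is `G(U₀)S` with
`S = D R^per D* A = D R^per f ∈ E_𝔤^per(P)`, so (3.47)@−3 for `G` (the binder, at `J := S`) and §1's `|S|₍₋₃₎ ≤ 2K(Lᵐ)³|f|₍₋₂₎` give the three lines with `c_S = B₀·2K(Lᵐ)³`,
`K = max{1, PᵈC_τ∕κ}`; the uniform bound is periodicity of `G(U₀)S`.  Threshold `a_S = a_T`.  dag-n06-b g24's `srcAtIPer_of_globAtIPer_univ` at any `Ω` with `Ω₀ = ℤᵈ`.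
[cite: Balaban1985BackgroundPropagators, (3.47) p.398, (3.42) p.397, (3.26)–(3.27) p.395, (3.20)–(3.22) p.394; Balaban1985RegularSpaces, Thm 8 + (1.146) p.101, (1.58) p.86, p.92, p.77] -/
theorem srcAtIPer_of_globAtIPer_of_zero (hτt : ∀ a b : 𝔸, τ (a * b) = τ (b * a)) (hτs : ∀ a : 𝔸, τ (star a) = starRingEnd ℂ (τ a))
    (hτp : ∀ a : 𝔸, a ≠ 0 → 0 < (τ (star a * a)).re) {Cτ : ℝ} (hCτ : ∀ x y : 𝔸, |(τ (star x * y)).re| ≤ Cτ * ‖x‖ * ‖y‖)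
    {κ : ℝ} (hκ : 0 < κ) (hκle : ∀ a : 𝔸, κ * ‖a‖ ^ 2 ≤ (τ (star a * a)).re) (hL : 1 ≤ L)
    (ΛbP : ℕ → ℕ → Set (Site d × Fin d)) (ops₀ : ℝ → ZdIdx d L → ℕ → OpsZd d 𝔸) {M : ℝ} {i : ZdIdx d L} (hΩ : i.Ω 0 = Set.univ)
    {m : ℕ} (hP : L ^ m ∣ P) {aT B₀ : ℝ} (hB₀ : 0 ≤ B₀) (h : GlobAtIPer P L (opsAllZdPer τ L P ΛbP ops₀) aT B₀ M i m) :
    SrcAtIPer P L (opsAllZdPer τ L P ΛbP ops₀) aT (B₀ * (2 * max 1 (((box (d := d) P).card : ℝ) * Cτ / κ) * ((L : ℝ) ^ m) ^ 3)) M i m := by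
  intro α₀ U₀ hU₀ hper hα hαT hIn A hAp _ _ f hfp _ hfB hcl
  set o : OpsZd d 𝔸 := opsAllZdPer τ L P ΛbP ops₀ M i m with ho
  set S : Site d → Fin d → 𝔸 := fun z κ => o.DRDs U₀ A z κ with hS_def
  have hS : S ∈ domSubHPer (d := d) (𝔸 := 𝔸) P := DRDs_mem_domSubHPer τ P hτs hτp (withDpZd (withQQP τ L ΛbP ops₀)) M i m hU₀ hper A
  obtain ⟨h1, h2, h4⟩ := h α₀ U₀ hU₀ hper hα hαT hIn S hS
  have hSN : bondNorm L m i.η (-(3 : ℝ)) i.Ω S ≤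
      2 * max 1 (((box (d := d) P).card : ℝ) * Cτ / κ) * ((L : ℝ) ^ m) ^ 3 * msup L i.k i.η (-(2 : ℝ)) (fun j (x : Site d) => x ∈ i.Ω j) f :=
    bondNorm_DRDs_le_of_src_of_zero τ P hτt hτs hτp hCτ hκ hκle hL ΛbP ops₀ M hΩ hP hU₀ hper hAp hfp hfB hcl
  have hB : B₀ * bondNorm L m i.η (-(3 : ℝ)) i.Ω S ≤
      B₀ * (2 * max 1 (((box (d := d) P).card : ℝ) * Cτ / κ) * ((L : ℝ) ^ m) ^ 3) * msup L i.k i.η (-(2 : ℝ)) (fun j (x : Site d) => x ∈ i.Ω j) f := by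
    rw [mul_assoc]; exact mul_le_mul_of_nonneg_left hSN hB₀
  have hGp : IsPeriodic P (o.Gop U₀ S) := B9Thm33GlobalBlockWitnessZdPer.gop_isPeriodic_opsAllZdPer' τ ΛbP ops₀ M i m U₀ S
  exact ⟨⟨∑ κ : Fin d, ∑ ξ : Fin d → ZMod P, ‖o.Gop U₀ S (tlift ξ) κ‖, fun y μ => norm_le_sum_cell_of_isPeriodic P hGp y μ⟩,
    h1.trans hB, h2.trans hB, h4.trans hB⟩

/-- ★★★ **`HolderAtIH2Per ⟹ SrcHolderAtIH2Per` FOR THE GENUINE PERIODIC RECORD AT A MEMBER WITH `Ω₀ = ℤᵈ`** (any class, any nested `Ω_j`; `0 ≤ β`, integer lengths,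
`2 ≤ d`): the both-points Hölder binder at `J := S = D R^per f`, §1's size of `S`, and the boundedness of the Hölder family from the periodicity of `D G(U₀)S`:
`c_Sβ = C_β·2K(Lᵐ)³`.  dag-n06-b g24's `srcHolderAtIH2Per_of_globAtIPer_univ` went through the Hölder-from-global knit (hence «Ω_j = ℤᵈ»); here the Hölder binder is the INPUT.
[cite: Balaban1985BackgroundPropagators, (3.45), (3.43) p.398, (3.40) p.397, (3.26) p.395; Balaban1985RegularSpaces, Thm 8 + (1.146) p.101, (1.59) p.86, (1.39) p.82, p.77] -/
theorem srcHolderAtIH2Per_of_holderAtIH2Per_of_zero (hd2 : 2 ≤ d) (hτt : ∀ a b : 𝔸, τ (a * b) = τ (b * a)) (hτs : ∀ a : 𝔸, τ (star a) = starRingEnd ℂ (τ a))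
    (hτp : ∀ a : 𝔸, a ≠ 0 → 0 < (τ (star a * a)).re) {Cτ : ℝ} (hCτ : ∀ x y : 𝔸, |(τ (star x * y)).re| ≤ Cτ * ‖x‖ * ‖y‖)
    {κ : ℝ} (hκ : 0 < κ) (hκle : ∀ a : 𝔸, κ * ‖a‖ ^ 2 ≤ (τ (star a * a)).re) (hL : 1 ≤ L)
    (ΛbP : ℕ → ℕ → Set (Site d × Fin d)) (ops₀ : ℝ → ZdIdx d L → ℕ → OpsZd d 𝔸) {M : ℝ} {i : ZdIdx d L} (hΩ : i.Ω 0 = Set.univ)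
    {m : ℕ} (hP : L ^ m ∣ P) {aT Cβ : ℝ} (hCβ : 0 ≤ Cβ) {β : ℝ} (hβ : 0 ≤ β) {len : Site d → ℝ} (hlen : ∀ v : Site d, 0 < len v → 1 ≤ len v)
    (h : HolderAtIH2Per P L (opsAllZdPer τ L P ΛbP ops₀) aT Cβ β len M i m) :
    SrcHolderAtIH2Per P L (opsAllZdPer τ L P ΛbP ops₀) aT (Cβ * (2 * max 1 (((box (d := d) P).card : ℝ) * Cτ / κ) * ((L : ℝ) ^ m) ^ 3)) β len M i m := by
  intro α₀ U₀ hU₀ hper hα hαT hIn A hAp _ _ f hfp _ hfB hcl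
  have hη : 0 < i.η := i.hη
  have hLr : (1 : ℝ) ≤ L := by exact_mod_cast hL
  set o : OpsZd d 𝔸 := opsAllZdPer τ L P ΛbP ops₀ M i m with ho
  set S : Site d → Fin d → 𝔸 := fun z κ => o.DRDs U₀ A z κ with hS_def
  have hS : S ∈ domSubHPer (d := d) (𝔸 := 𝔸) P := DRDs_mem_domSubHPer τ P hτs hτp (withDpZd (withQQP τ L ΛbP ops₀)) M i m hU₀ hper A
  have h5 := h α₀ U₀ hU₀ hper hα hαT hIn S hS
  have hSN : bondNorm L m i.η (-(3 : ℝ)) i.Ω S ≤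
      2 * max 1 (((box (d := d) P).card : ℝ) * Cτ / κ) * ((L : ℝ) ^ m) ^ 3 * msup L i.k i.η (-(2 : ℝ)) (fun j (x : Site d) => x ∈ i.Ω j) f :=
    bondNorm_DRDs_le_of_src_of_zero τ P hτt hτs hτp hCτ hκ hκle hL ΛbP ops₀ M hΩ hP hU₀ hper hAp hfp hfB hcl
  refine ⟨?_, h5.trans (by rw [mul_assoc Cβ]; exact mul_le_mul_of_nonneg_left hSN hCβ)⟩
  -- boundedness of the Hölder family: `D G(U₀)S` is periodic, hence bounded
  set G : Site d → Fin d → 𝔸 := o.Gop U₀ S with hG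
  have hGp : IsPeriodic P G := B9Thm33GlobalBlockWitnessZdPer.gop_isPeriodic_opsAllZdPer' τ ΛbP ops₀ M i m U₀ S
  set c : ℝ := ∑ κ : Fin d, ∑ ξ : Fin d → ZMod P, ‖G (tlift ξ) κ‖ with hc
  have hGb : ∀ (y : Site d) (κ : Fin d), ‖G y κ‖ ≤ c := fun y κ => norm_le_sum_cell_of_isPeriodic P hGp y κ
  have hc0 : 0 ≤ c := (norm_nonneg _).trans (hGb 0 ⟨0, lt_of_lt_of_le (by norm_num) hd2⟩)
  have hU1 : ∀ y κ, U₀ y κ ∈ U1 𝔸 := fun y κ => unitaryUnits_le_U1 (hU₀ y κ)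
  have hFb : ∀ (ν κ : Fin d) (x : Site d), ‖covDerivFwd i.η U₀ ν (fun z => G z κ) x‖ ≤ i.η⁻¹ * (c + c) := fun ν κ x =>
    (norm_covDerivFwd_le hη (hU1 x ν) _).trans (mul_le_mul_of_nonneg_left (add_le_add (hGb _ _) (hGb _ _)) (inv_nonneg.2 hη.le))
  refine B8ScaledSupNorm.bdd_of_forall (c := ((L : ℝ) ^ m * i.η) ^ (2 + β) * ((i.η⁻¹ * (c + c) + i.η⁻¹ * (c + c)) * (i.η ^ β)⁻¹))
    fun j hj q hq => ?_
  obtain ⟨ν, κ, x, x'⟩ := q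
  have hq0 : 0 ≤ hquot i.η β len U₀ (covDerivFwd i.η U₀ ν fun z => G z κ) (x, x') := hquot_nonneg hη.le β U₀ _ hq.1
  rw [Real.norm_of_nonneg hq0]
  have hs0 : 0 < (L : ℝ) ^ j * i.η := by positivity
  have hsm : (L : ℝ) ^ j * i.η ≤ (L : ℝ) ^ m * i.η := mul_le_mul_of_nonneg_right (pow_le_pow_right₀ hLr hj) hη.le
  have hwle : weight L i.η (-(2 + β)) j ≤ ((L : ℝ) ^ m * i.η) ^ (2 + β) := by
    simp only [weight, neg_neg]
    exact Real.rpow_le_rpow hs0.le hsm (by linarith)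
  have hηβ : 0 < i.η ^ β := Real.rpow_pos_of_pos hη β
  have hden : i.η ^ β ≤ (i.η * len ((x, x').2 - (x, x').1)) ^ β := by
    apply Real.rpow_le_rpow hη.le _ hβ
    have := hlen _ hq.1.1
    nlinarith
  have hnum : ‖trans U₀ (x, x').1 (x, x').2 ((covDerivFwd i.η U₀ ν fun z => G z κ) (x, x').2) - (covDerivFwd i.η U₀ ν fun z => G z κ) (x, x').1‖ ≤
      i.η⁻¹ * (c + c) + i.η⁻¹ * (c + c) :=
    calc _ ≤ ‖trans U₀ (x, x').1 (x, x').2 ((covDerivFwd i.η U₀ ν fun z => G z κ) (x, x').2)‖ + ‖(covDerivFwd i.η U₀ ν fun z => G z κ) (x, x').1‖ :=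
          norm_sub_le _ _
      _ ≤ i.η⁻¹ * (c + c) + i.η⁻¹ * (c + c) := by rw [B9Eq340HolderZd.norm_trans hU1]; exact add_le_add (hFb ν κ x') (hFb ν κ x)
  have hquo : hquot i.η β len U₀ (covDerivFwd i.η U₀ ν fun z => G z κ) (x, x') ≤ (i.η⁻¹ * (c + c) + i.η⁻¹ * (c + c)) * (i.η ^ β)⁻¹ := by
    rw [B9Eq340HolderZd.hquot_def, div_eq_mul_inv]
    exact mul_le_mul hnum (inv_anti₀ hηβ hden) (inv_nonneg.2 (Real.rpow_nonneg (mul_nonneg hη.le hq.1.1.le) β)) (by positivity)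
  exact mul_le_mul hwle hquo hq0 (Real.rpow_nonneg (hs0.le.trans hsm) _)

end Binders

/-! ## §3  At every nested periodic member: THE FIVE ANALYTIC BINDERS OF THE N05 WITNESS SLOT, PER MEMBER, ONE THRESHOLD PAIR `(aI, aT)` -/

section Members

variable {θ : Stage3Params} [FiniteDimensional ℝ θ.𝔸] (τ : θ.𝔸 →ₗ[ℂ] ℂ) (hτp : ∀ x : θ.𝔸, x ≠ 0 → 0 < (τ (star x * x)).re)
  (hτt : ∀ x y : θ.𝔸, τ (x * y) = τ (y * x)) (hτs : ∀ x : θ.𝔸, τ (star x) = starRingEnd ℂ (τ x)) {P : ℕ} [NeZero P]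

include hτp hτt hτs in
/-- ★★★★★ **THE FIVE ANALYTIC BINDERS OF THE N05 WITNESS SLOT OF RECORD, INHABITED AT EVERY NESTED PERIODIC MEMBER FOR THE GENUINE RECORD OVER PRINT'S CLASS, PER MEMBER**
(`2 ≤ D`, `a : IdxB8SubDPer θ P`, `m ≤ k`, `0 ≤ β`, integer lengths, faithful Hermitian tracial `τ` with `|Re τ(x*y)| ≤ C_τ‖x‖‖y‖`): `∃ aI aT B₀ > 0, K ≥ 1` with
`InvAtHIPer … aI` (Thm 3.11, `B9Thm311ClassCompactnessZdPerNested`), `GlobAtIPer … aT B₀` ((3.47)@−3), `HolderAtIH2Per … aT (2B₀(Lᵐ)^β) β len` ((3.45)), `SrcAtIPer … aT (B₀·2K(Lᵐ)³)`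
and `SrcHolderAtIH2Per … aT (2B₀(Lᵐ)^β·2K(Lᵐ)³) β len` ((3.42)₃ ∕ (3.43) for the source term) — the N05 head's `hinv ∕ hglob ∕ hhol ∕ hsrc ∕ hsrcH` texts at `(a, m)` for
`opsAllZdPer τ θ.L P (fun k j => towerBondsP θ.L a.toZdIdx.Ω (a.toZdIdx.Λs k) j) ops₀`.  NO binder of Bałaban's left at the member; dag-n06-b g24's
`srcBinders_opsAllZdPer_torusIdx` is the all-torus member.  The constants are PER MEMBER (compactness); the head's uniformity over members is NOT claimed.
[cite: Balaban1985BackgroundPropagators, Thm 3.11 p.416, Thm 3.3 p.399, (3.42) p.397, (3.43)–(3.47) p.398, (3.20)–(3.22) p.394, (3.26)–(3.27) p.395; Balaban1985RegularSpaces, Thm 8 + (1.146) p.101, (1.58)–(1.59) p.86, (1.3)–(1.6) p.77, (1.31) p.82, p.77 («Ω_j ⊂ T_η»)] -/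
theorem IdxB8SubDPer.binders_opsAllZdPer (hD2 : 2 ≤ θ.D) {Cτ : ℝ} (hCτ : ∀ x y : θ.𝔸, |(τ (star x * y)).re| ≤ Cτ * ‖x‖ * ‖y‖)
    (a : IdxB8SubDPer θ P) {m : ℕ} (hm : m ≤ a.toZdIdx.k) (ops₀ : ℝ → ZdIdx θ.D θ.L → ℕ → OpsZd θ.D θ.𝔸) (M : ℝ)
    {β : ℝ} (hβ : 0 ≤ β) {len : Site θ.D → ℝ} (hlen : ∀ v : Site θ.D, 0 < len v → 1 ≤ len v) :
    ∃ aI : ℝ, 0 < aI ∧ ∃ aT : ℝ, 0 < aT ∧ ∃ B₀ : ℝ, 0 < B₀ ∧ ∃ K : ℝ, 1 ≤ K ∧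
      InvAtHIPer P θ.L (opsAllZdPer τ θ.L P (fun k j => towerBondsP θ.L a.toZdIdx.Ω (a.toZdIdx.Λs k) j) ops₀) aI M a.toZdIdx m ∧
      GlobAtIPer P θ.L (opsAllZdPer τ θ.L P (fun k j => towerBondsP θ.L a.toZdIdx.Ω (a.toZdIdx.Λs k) j) ops₀) aT B₀ M a.toZdIdx m ∧
      HolderAtIH2Per P θ.L (opsAllZdPer τ θ.L P (fun k j => towerBondsP θ.L a.toZdIdx.Ω (a.toZdIdx.Λs k) j) ops₀) aT (2 * B₀ * (((θ.L : ℝ) ^ m) ^ β)) β len M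
        a.toZdIdx m ∧
      SrcAtIPer P θ.L (opsAllZdPer τ θ.L P (fun k j => towerBondsP θ.L a.toZdIdx.Ω (a.toZdIdx.Λs k) j) ops₀) aT (B₀ * (2 * K * ((θ.L : ℝ) ^ m) ^ 3)) M
        a.toZdIdx m ∧
      SrcHolderAtIH2Per P θ.L (opsAllZdPer τ θ.L P (fun k j => towerBondsP θ.L a.toZdIdx.Ω (a.toZdIdx.Λs k) j) ops₀) aT
        (2 * B₀ * (((θ.L : ℝ) ^ m) ^ β) * (2 * K * ((θ.L : ℝ) ^ m) ^ 3)) β len M a.toZdIdx m := by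
  haveI : NeZero θ.L := ⟨by have := θ.two_le_L; omega⟩
  have hL1 : 1 ≤ θ.L := le_trans (by norm_num) θ.two_le_L
  have hD : 0 < θ.D := lt_of_lt_of_le (by norm_num) hD2
  obtain ⟨aI, haI, hinv⟩ := B9Thm311ClassCompactnessZdPerNested.IdxB8SubDPer.invAtHIPer_opsAllZdPer τ hτp hτt hτs hD a hm ops₀ M
  obtain ⟨aT, haT, B₀, hB₀, hglob, hholAll⟩ :=
    B9Thm33GlobalBlockWitnessZdPerNested.IdxB8SubDPer.glob_holderAtIH2Per_opsAllZdPer τ hτp hτt hτs hD hCτ a hm ops₀ M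
  obtain ⟨κ, hκ, hκle⟩ := exists_norm_sq_le_re_trace τ hτp
  have hhol := hholAll β hβ len hlen
  have hCβ0 : 0 ≤ 2 * B₀ * (((θ.L : ℝ) ^ m) ^ β) := by
    have : 0 ≤ ((θ.L : ℝ) ^ m) ^ β := Real.rpow_nonneg (by positivity) β
    positivity
  refine ⟨aI, haI, aT, haT, B₀, hB₀, max 1 (((box (d := θ.D) P).card : ℝ) * Cτ / κ), le_max_left _ _, hinv, hglob, hhol, ?_, ?_⟩
  · exact srcAtIPer_of_globAtIPer_of_zero τ θ.L P hτt hτs hτp hCτ hκ hκle hL1 _ ops₀ a.Ω_zero (a.dvd_level hm) hB₀.le hglob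
  · exact srcHolderAtIH2Per_of_holderAtIH2Per_of_zero τ θ.L P hD2 hτt hτs hτp hCτ hκ hκle hL1 _ ops₀ a.Ω_zero (a.dvd_level hm) hCβ0 hβ hlen hhol

end Members

/-! ## §4  One constant set for ALL truncations `m ≤ K` at a fixed member (the N05 head's `∀ m ≤ k` shape, per member) -/

section AllLevels

variable {θ : Stage3Params} [FiniteDimensional ℝ θ.𝔸] (τ : θ.𝔸 →ₗ[ℂ] ℂ) (hτp : ∀ x : θ.𝔸, x ≠ 0 → 0 < (τ (star x * x)).re)
  (hτt : ∀ x y : θ.𝔸, τ (x * y) = τ (y * x)) (hτs : ∀ x : θ.𝔸, τ (star x) = starRingEnd ℂ (τ x)) {P : ℕ} [NeZero P]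

include hτp hτt hτs in
/-- ★★★★★ **THE FIVE BINDERS WITH ONE CONSTANT SET FOR EVERY TRUNCATION `m ≤ K` AT A FIXED NESTED PERIODIC MEMBER** (`K ≤ k`; `2 ≤ D`, `0 ≤ β`, integer lengths): `∃ aI aT > 0,
B₀ > 0, C_β c_S c_Sβ ≥ 0` with, for ALL `m ≤ K`, `InvAtHIPer … aI M a m ∧ GlobAtIPer … aT B₀ M a m ∧ HolderAtIH2Per … aT C_β β len M a m ∧ SrcAtIPer … aT c_S M a m ∧
SrcHolderAtIH2Per … aT c_Sβ β len M a m` — the N05 head's five binder texts at the member `a` in its `∀ m ≤ k` shape (with `a_S := a_T`), from §3 per truncation by `min ∕ max`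
(the binders are antitone in the thresholds and monotone in the constants: g22∕g23∕g24's `invAtHIPer_anti ∕ globAtIPer_anti ∕ holderAtIH2Per_anti ∕ srcAtIPer_anti ∕
srcHolderAtIH2Per_anti`).  PER MEMBER; uniformity over members NOT claimed.
[cite: Balaban1985BackgroundPropagators, Thm 3.11 p.416, Thm 3.3 p.399, (3.42) p.397, (3.43)–(3.47) p.398; Balaban1985RegularSpaces, Thm 8 + (1.146) p.101, (1.58)–(1.59) p.86, (1.3)–(1.6) p.77, (1.31) p.82] -/
theorem IdxB8SubDPer.binders_opsAllZdPer_allLevels (hD2 : 2 ≤ θ.D) {Cτ : ℝ} (hCτ : ∀ x y : θ.𝔸, |(τ (star x * y)).re| ≤ Cτ * ‖x‖ * ‖y‖)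
    (a : IdxB8SubDPer θ P) (ops₀ : ℝ → ZdIdx θ.D θ.L → ℕ → OpsZd θ.D θ.𝔸) (M : ℝ)
    {β : ℝ} (hβ : 0 ≤ β) {len : Site θ.D → ℝ} (hlen : ∀ v : Site θ.D, 0 < len v → 1 ≤ len v) {K : ℕ} (hK : K ≤ a.toZdIdx.k) :
    ∃ aI : ℝ, 0 < aI ∧ ∃ aT : ℝ, 0 < aT ∧ ∃ B₀ : ℝ, 0 < B₀ ∧ ∃ Cβ : ℝ, 0 ≤ Cβ ∧ ∃ cS : ℝ, 0 ≤ cS ∧ ∃ cSβ : ℝ, 0 ≤ cSβ ∧ ∀ m, m ≤ K →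
      InvAtHIPer P θ.L (opsAllZdPer τ θ.L P (fun k j => towerBondsP θ.L a.toZdIdx.Ω (a.toZdIdx.Λs k) j) ops₀) aI M a.toZdIdx m ∧
      GlobAtIPer P θ.L (opsAllZdPer τ θ.L P (fun k j => towerBondsP θ.L a.toZdIdx.Ω (a.toZdIdx.Λs k) j) ops₀) aT B₀ M a.toZdIdx m ∧
      HolderAtIH2Per P θ.L (opsAllZdPer τ θ.L P (fun k j => towerBondsP θ.L a.toZdIdx.Ω (a.toZdIdx.Λs k) j) ops₀) aT Cβ β len M a.toZdIdx m ∧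
      SrcAtIPer P θ.L (opsAllZdPer τ θ.L P (fun k j => towerBondsP θ.L a.toZdIdx.Ω (a.toZdIdx.Λs k) j) ops₀) aT cS M a.toZdIdx m ∧
      SrcHolderAtIH2Per P θ.L (opsAllZdPer τ θ.L P (fun k j => towerBondsP θ.L a.toZdIdx.Ω (a.toZdIdx.Λs k) j) ops₀) aT cSβ β len M a.toZdIdx m := by
  have hL0 : (0 : ℝ) ≤ (θ.L : ℝ) := by positivity
  -- one truncation, with non-negative derived constants
  have one : ∀ m, m ≤ a.toZdIdx.k → ∃ aI : ℝ, 0 < aI ∧ ∃ aT : ℝ, 0 < aT ∧ ∃ B₀ : ℝ, 0 < B₀ ∧ ∃ Cβ : ℝ, 0 ≤ Cβ ∧ ∃ cS : ℝ, 0 ≤ cS ∧ ∃ cSβ : ℝ, 0 ≤ cSβ ∧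
      InvAtHIPer P θ.L (opsAllZdPer τ θ.L P (fun k j => towerBondsP θ.L a.toZdIdx.Ω (a.toZdIdx.Λs k) j) ops₀) aI M a.toZdIdx m ∧
      GlobAtIPer P θ.L (opsAllZdPer τ θ.L P (fun k j => towerBondsP θ.L a.toZdIdx.Ω (a.toZdIdx.Λs k) j) ops₀) aT B₀ M a.toZdIdx m ∧
      HolderAtIH2Per P θ.L (opsAllZdPer τ θ.L P (fun k j => towerBondsP θ.L a.toZdIdx.Ω (a.toZdIdx.Λs k) j) ops₀) aT Cβ β len M a.toZdIdx m ∧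
      SrcAtIPer P θ.L (opsAllZdPer τ θ.L P (fun k j => towerBondsP θ.L a.toZdIdx.Ω (a.toZdIdx.Λs k) j) ops₀) aT cS M a.toZdIdx m ∧
      SrcHolderAtIH2Per P θ.L (opsAllZdPer τ θ.L P (fun k j => towerBondsP θ.L a.toZdIdx.Ω (a.toZdIdx.Λs k) j) ops₀) aT cSβ β len M a.toZdIdx m := by
    intro m hm
    obtain ⟨aI, haI, aT, haT, B₀, hB₀, K', hK', hinv, hglob, hhol, hsrc, hsrcH⟩ :=
      IdxB8SubDPer.binders_opsAllZdPer τ hτp hτt hτs hD2 hCτ a hm ops₀ M hβ hlen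
    have hLmβ : 0 ≤ ((θ.L : ℝ) ^ m) ^ β := Real.rpow_nonneg (pow_nonneg hL0 m) β
    have hK0 : 0 ≤ K' := zero_le_one.trans hK'
    exact ⟨aI, haI, aT, haT, B₀, hB₀, _, by positivity, _, by positivity, _, by positivity, hinv, hglob, hhol, hsrc, hsrcH⟩
  induction K with
  | zero =>
    obtain ⟨aI, haI, aT, haT, B₀, hB₀, Cβ, hCβ, cS, hcS, cSβ, hcSβ, h⟩ := one 0 hK
    exact ⟨aI, haI, aT, haT, B₀, hB₀, Cβ, hCβ, cS, hcS, cSβ, hcSβ, fun m hm => by rw [Nat.le_zero.1 hm]; exact h⟩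
  | succ K ih =>
    obtain ⟨aI₁, haI₁, aT₁, haT₁, B₁, hB₁, Cβ₁, hCβ₁, cS₁, hcS₁, cSβ₁, hcSβ₁, h₁⟩ := ih ((Nat.le_succ K).trans hK)
    obtain ⟨aI₂, haI₂, aT₂, haT₂, B₂, hB₂, Cβ₂, hCβ₂, cS₂, hcS₂, cSβ₂, hcSβ₂, h₂⟩ := one (K + 1) hK
    refine ⟨min aI₁ aI₂, lt_min haI₁ haI₂, min aT₁ aT₂, lt_min haT₁ haT₂, max B₁ B₂, lt_max_of_lt_left hB₁, max Cβ₁ Cβ₂, le_max_of_le_left hCβ₁,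
      max cS₁ cS₂, le_max_of_le_left hcS₁, max cSβ₁ cSβ₂, le_max_of_le_left hcSβ₁, fun m hm => ?_⟩
    rcases Nat.lt_or_eq_of_le hm with hlt | rfl
    · obtain ⟨g1, g2, g3, g4, g5⟩ := h₁ m (Nat.lt_succ_iff.1 hlt)
      exact ⟨B9Eq327GreenZdHermPer.invAtHIPer_anti (h := min_le_left _ _) (hI := g1),
        B9SupplySockB9P3ZdPer.globAtIPer_anti (ha := min_le_left _ _) (hB := le_max_left _ _) (h := g2),
        B9SupplySockB9P3ZdH2Per.holderAtIH2Per_anti (ha := min_le_left _ _) (hC := le_max_left _ _) (h := g3),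
        B9SupplySockB9P3ZdSrcPer.srcAtIPer_anti (ha := min_le_left _ _) (hc := le_max_left _ _) (h := g4),
        B9SupplySockB9P3ZdSrcPer.srcHolderAtIH2Per_anti (ha := min_le_left _ _) (hc := le_max_left _ _) (h := g5)⟩
    · obtain ⟨g1, g2, g3, g4, g5⟩ := h₂
      exact ⟨B9Eq327GreenZdHermPer.invAtHIPer_anti (h := min_le_right _ _) (hI := g1),
        B9SupplySockB9P3ZdPer.globAtIPer_anti (ha := min_le_right _ _) (hB := le_max_right _ _) (h := g2),
        B9SupplySockB9P3ZdH2Per.holderAtIH2Per_anti (ha := min_le_right _ _) (hC := le_max_right _ _) (h := g3),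
        B9SupplySockB9P3ZdSrcPer.srcAtIPer_anti (ha := min_le_right _ _) (hc := le_max_right _ _) (h := g4),
        B9SupplySockB9P3ZdSrcPer.srcHolderAtIH2Per_anti (ha := min_le_right _ _) (hc := le_max_right _ _) (h := g5)⟩

end AllLevels

/-! ## §5  The reading on the print-class cut `IdxB8SubDPerκ θ P M₁ R` (the N05 head's index; `j.toZdIdx = j.toPer.toZdIdx` by `rfl`) -/

section Kappa

variable {θ : Stage3Params} [FiniteDimensional ℝ θ.𝔸] (τ : θ.𝔸 →ₗ[ℂ] ℂ) (hτp : ∀ x : θ.𝔸, x ≠ 0 → 0 < (τ (star x * x)).re)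
  (hτt : ∀ x y : θ.𝔸, τ (x * y) = τ (y * x)) (hτs : ∀ x : θ.𝔸, τ (star x) = starRingEnd ℂ (τ x)) {P M₁ R : ℕ} [NeZero P]

include hτp hτt hτs in
/-- ★★★★★ **THE FIVE BINDERS AT EVERY MEMBER OF THE N05 HEAD's OWN INDEX `IdxB8SubDPerκ θ P Mκ Rκ`, ONE CONSTANT SET FOR ALL `m ≤ k` OF THAT MEMBER** — §4 read through
`IdxB8SubDPerκ.toPer` (the cut forgets to the periodic index; `toZdIdx` agrees by `rfl`): for every `j : IdxB8SubDPerκ θ P M₁ R`, `∃ aI aT > 0, B₀ > 0, C_β c_S c_Sβ ≥ 0, ∀ m ≤ k`,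
`InvAtHIPer P θ.L (opsAllZdPer τ θ.L P (fun k l => towerBondsP θ.L j.toZdIdx.Ω (j.toZdIdx.Λs k) l) ops₀) aI M j.toZdIdx m ∧ GlobAtIPer … aT B₀ … ∧ HolderAtIH2Per … aT C_β β len … ∧
SrcAtIPer … aT c_S … ∧ SrcHolderAtIH2Per … aT c_Sβ β len …` — the texts of `hinv ∕ hglob ∕ hhol ∕ hsrc ∕ hsrcH` of
`…N05SubBP2DK2PerKappaSlotExistsOfBindersLettersPer(Door)` AT THE MEMBER (`a_S := a_T`).  PER MEMBER: the head's single constant set over ALL members is NOT supplied here.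
[cite: Balaban1985BackgroundPropagators, Thm 3.11 p.416, Thm 3.3 p.399, (3.42) p.397, (3.43)–(3.47) p.398; Balaban1985RegularSpaces, Thm 8 + (1.146) p.101, (1.58)–(1.59) p.86, (1.3)–(1.5) p.77, (1.31) p.82] -/
theorem IdxB8SubDPerκ.binders_opsAllZdPer_allLevels (hD2 : 2 ≤ θ.D) {Cτ : ℝ} (hCτ : ∀ x y : θ.𝔸, |(τ (star x * y)).re| ≤ Cτ * ‖x‖ * ‖y‖)
    (j : IdxB8SubDPerκ θ P M₁ R) (ops₀ : ℝ → ZdIdx θ.D θ.L → ℕ → OpsZd θ.D θ.𝔸) (M : ℝ)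
    {β : ℝ} (hβ : 0 ≤ β) {len : Site θ.D → ℝ} (hlen : ∀ v : Site θ.D, 0 < len v → 1 ≤ len v) :
    ∃ aI : ℝ, 0 < aI ∧ ∃ aT : ℝ, 0 < aT ∧ ∃ B₀ : ℝ, 0 < B₀ ∧ ∃ Cβ : ℝ, 0 ≤ Cβ ∧ ∃ cS : ℝ, 0 ≤ cS ∧ ∃ cSβ : ℝ, 0 ≤ cSβ ∧ ∀ m, m ≤ j.toZdIdx.k →
      InvAtHIPer P θ.L (opsAllZdPer τ θ.L P (fun k l => towerBondsP θ.L j.toZdIdx.Ω (j.toZdIdx.Λs k) l) ops₀) aI M j.toZdIdx m ∧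
      GlobAtIPer P θ.L (opsAllZdPer τ θ.L P (fun k l => towerBondsP θ.L j.toZdIdx.Ω (j.toZdIdx.Λs k) l) ops₀) aT B₀ M j.toZdIdx m ∧
      HolderAtIH2Per P θ.L (opsAllZdPer τ θ.L P (fun k l => towerBondsP θ.L j.toZdIdx.Ω (j.toZdIdx.Λs k) l) ops₀) aT Cβ β len M j.toZdIdx m ∧
      SrcAtIPer P θ.L (opsAllZdPer τ θ.L P (fun k l => towerBondsP θ.L j.toZdIdx.Ω (j.toZdIdx.Λs k) l) ops₀) aT cS M j.toZdIdx m ∧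
      SrcHolderAtIH2Per P θ.L (opsAllZdPer τ θ.L P (fun k l => towerBondsP θ.L j.toZdIdx.Ω (j.toZdIdx.Λs k) l) ops₀) aT cSβ β len M j.toZdIdx m :=
  IdxB8SubDPer.binders_opsAllZdPer_allLevels τ hτp hτt hτs hD2 hCτ j.toPer ops₀ M hβ hlen le_rfl

end Kappa

end Literature.MathematicalPhysics.QuantumFieldTheory.Balaban1983to89.B9Thm33SourceWitnessZdPerNested

end
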